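import Mathlib
import HarnessLib
import HarnessLib.Audit
import Summits.NavierStokesRegularity.Statement
import Literature.Analysis.FluidPDE.ClassicalSolution
import Literature.Analysis.FluidPDE.LerayHopf
import Literature.Analysis.FluidPDE.SuitableWeak
import Literature.Analysis.FluidPDE.VectorCalculus
import Literature.Analysis.FluidPDE.NSBoundedMildOseen
import Literature.Analysis.FluidPDE.BlowupAncientSolution
import Literature.Analysis.FluidPDE.KNSSSmoothingHolds
import Literature.Analysis.FluidPDE.NSBoundedMildOseenClassical
import Summits.NavierStokesRegularity.NavierStokesRegularity.Theses.RootDecompTerminalEnergy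
import Summits.NavierStokesRegularity.NavierStokesRegularity.Theses.RootDecompAlignedCore
import Summits.NavierStokesRegularity.NavierStokesRegularity.Theses.RootDecompCoreDynamics
import Summits.NavierStokesRegularity.NavierStokesRegularity.Theses.VorticityPace
import Summits.NavierStokesRegularity.NavierStokesRegularity.Theses.GaldiLiouvilleGate
import Summits.NavierStokesRegularity.NavierStokesRegularity.Theorems.VorticityPacePaceZoom
import Summits.NavierStokesRegularity.NavierStokesRegularity.Theorems.NoBlowupToClay
import Summits.NavierStokesRegularity.NavierStokesRegularity.Theorems.QuarterJoltNoTerminalJoltPosition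
import HarnessLib.Audit.Status.Attr

/-!
Route: RootDecompFrugalCore

# Route RootDecompFrugalCore — Root decomposition g3 under N11's residual E₂⁗ — Clay (A) ⟸ P1 ∧ P2 ∧
J1 ∧ (D₁ ∧ D₂ ∧ D₃) ∧ D₅ ∧ E₂⁽⁶⁾ («frugal cores extend; lavish cores are the residual»)

ROOT DECOMPOSITION CELL decomp-ns (D-0178/D-0179, RESIDUAL MODE, blocker-first), node booked by
route-writer decomp-ns-writer-1 (g3): the critic-CLEARED lens-2 (g6)
node FrugalCoreDichotomy («structural dichotomy, special vs generic», run on N11's residual E₂⁗ =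
`RootDecompCoreDynamics.TameLiveIsTypeI` stmt-NavierStokesRegularity-28715;
CRITIC-LEDGER row of 06:19:08Z CLEARED, «row-56 objection RESOLVED»). PARENT POINTER: refines N11
`route-NavierStokesRegularity-RootDecompCoreDynamics` at :28715
(E₂⁗ REPLACED here by D₅ ∧ E₂⁽⁶⁾: kernel `closes_residual_N11 : FrugalCoreExtends →
TameLavishIsTypeI → RootDecompCoreDynamics.TameLiveIsTypeI`, EXACT
`tameLive_iff_cells6 : E₂⁗ ⟺ C₅ ∧ E₂⁽⁶⁾` with C₅ ⟸ D₅); N11's other items are carried: P1 =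
stmt-1217, P2 = 24827, J1 = 24829 VERBATIM (dedup by signature) and the
three BORN structured-core criteria D₁ = 27619 (N9), D₂ = 28713, D₃ = 28714 (N11) BY NAME as ONE
support bundle `StructuredCoresExtend` (the born parent layer — no new
content; the 8-binder verbatim form is what BC1 forbids; N11's file keeps them as separate items);
concludes the ROOT through N11's own `RootDecompCoreDynamics.closes`
(lens `closes_via_N11`; HOME/decomp-ns-lens-2/FrugalCoreDichotomy.lean sha256
ea3efd4f1bd33822b969f1bea3ba90899fa1af2ad9e50aa411785f6edc582537 (1373 lines; lean rc 0 / 0 err / 0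
warn / 0 sorry; axioms(closes*, node_iff, parabolicGaldiLiouville_of_liouville,
frugalPaceZoom_of_recordZoomAncient) standard — critic CRITIC-LEDGER row 2026-08-30T06:19:08Z
CLEARED)).

THESIS. It suffices to show X = P1 ∧ P2 ∧ J1 ∧ (D₁ ∧ D₂ ∧ D₃) ∧ D₅ ∧ E₂⁽⁶⁾. Frame: a classical NS
solution on [0,T) (resp. a maximal smooth solution of lifespan T),
Leray–Hopf from its own rapidly decaying datum, ν > 0; W(t,y) = |curl u(t)(y)|; (t,y) is a PACE
RECORD (constant C) when |u(s,x)|² ≤ C(1+W) on [0,t] × ℝ³ (the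
lineage's g2 clause); Z(s) = ∫|∇u(s)|² typed junk-free as `∫⁻ x, ENNReal.ofReal (frobeniusNormSq
(fderiv ℝ (u s) x))` (the enstrophy currency of GaldiLiouvilleGate);
ONE CORE'S BUDGET is ν^{3/2}W^{1/2}; the FRUGALITY INDEX μ_Z = Z/(ν^{3/2}W^{1/2}) = Gibbon's D_1/D_∞
exactly. The core is FRUGAL (`∃ C M`, cofinally in t ↑ T a pace
record below which Z(s) ≤ M√(1+W) for ALL s ∈ [0,t]) or LAVISH (its negation).
- D₅ (`FrugalCoreExtends`, crux r3, NEW, the ATTACKED conjunct): a frugal-cored classical Leray–Hopf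
solution on [0,T) extends smoothly past T. Skeleton D₅ ⟸ QZ ∧ X2
  (`frugalCoreExtends_of_leaves`, kernel): QZ (`FrugalPaceZoom`, aside, FIRST PROVER TARGET,
EXPECTED THEOREM) — in zoom variables at frugal pace records the
  running enstrophy bound rides into every past slice (λ_k Z ≤ M'), so the PROVED pace zoom
`Summit.NavierStokesRegularity.NavierStokesRegularity.Theorems.vorticityPace_paceZoom_proof` (7781)
plus two passengers (Fatou on balls for ∫|∇v_k|²;
  Sobolev H¹ ⊂ L⁶ + weak lsc) and `knss2009_smoothing_holds` yields a NONTRIVIAL bounded ancient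
mild flow, jointly smooth, with bounded enstrophy and L⁶ slices;
  X2 = the EXISTING crux `GaldiLiouvilleGate.ParabolicGaldiLiouville` stmt-0893 BY NAME (such flows
vanish) — the shared hard core, WEAKER than (L) `VorticityPace.Liouville`
  10551 in kernel (`parabolicGaldiLiouville_of_liouville`, PROVED in the lens, re-checked in the
skeleton). D₅ ⟸ (L) in kernel through PROVED 7781.
- E₂⁽⁶⁾ (`TameLavishIsTypeI`, crux r2, NEW, DECLARED RESIDUAL): a TAME maximal blow-up whose core is
live (neither coherent, columnar nor frozen — N11's clauses verbatim)
  and LAVISH is Type I. LOADED (declared): every printed / computed Type-II candidate is lavish (K9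
tube pair μ_Z 2e5–2e6 and growing with Re; Hou 2022 ring-sheet;
  Moffatt–Kimura; Kang–Protas; thin rings; Tao-type cascades with undissipated spent stages; every
ballistic core — kernel `not_isFrugalCore_of_ballistic`).
- StructuredCoresExtend (support): D₁ ∧ D₂ ∧ D₃ by name (born 27619 ∧ 28713 ∧ 28714; closes as `⟨h₁,
h₂, h₃⟩` when they close; attacked in N9/N11).
- P1 (`NoTypeIBlowup` = 1217), P2 (`NoEnergyAtom` = 24827), J1 (`AtomFreeBlowupIsTame` = 24829):
N1/N11 items verbatim.
Lean: `theorem closes (hI : NoTypeIBlowup) (hA : NoEnergyAtom) (hJ1 : AtomFreeBlowupIsTame) (hS :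
StructuredCoresExtend) (hD5 : FrugalCoreExtends)
(hL6 : TameLavishIsTypeI) : NavierStokesRegularity` — SIX binders, all consumed: N11's
`RootDecompCoreDynamics.closes hS.2.1 hS.2.2 (E₂⁗) hS.1 hA hJ1 hI` with E₂⁗
rebuilt by excluded middle on «frugal core»: frugal ⟹ D₅ extends the solution, contradicting
maximality; lavish ⟹ E₂⁽⁶⁾.

DEPENDENCY SHAPE. E₂⁗ ⟺ C₅ ∧ E₂⁽⁶⁾ (EXACT, `tameLive_iff_cells6`); C₅ `TameFrugalIsTypeI` ⟸ D₅ ⟸ QZ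
∧ X2; QZ ⟸ Z = `GaldiLiouvilleGate.RecordZoomAncient` 0894 (kernel
`frugalPaceZoom_of_recordZoomAncient`: QZ is WEAKER than the gate's own zoom crux — frugality is
exactly the regime r_n ≍ ℓ where Z's non-triviality is free);
X2 ⟸ (L) (kernel); D₅ ⟸ (L) (kernel via 7781); R₅ `EvanescentCoreExtends` ⟸ D₅ (kernel; BC5 rung
plan); E₂⁽⁶⁾ ⟸ E₂⁗ (restriction, kernel `tameLavish_of_tameLive`) —
STRICTLY mod the UNDECIDED separating class «tame FRUGAL-cored Type-II collapse» (compact viscous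
core Re_core ≲ C with a self-similar halo, W ~ (T−t)^{−α}, 1 < α < 2:
frugal, finite dissipation, tame, atom-free, L³ log-divergent — excluded nowhere in print, excluded
here by D₅). S ⟹ D₅, QZ, R₅, E₂⁽⁶⁾ by vacuity (`*_of_root` via
`navierStokesRegularity_iff_noBlowup`); X2 is INCOMPARABLE with S (quantifies over ancient flows,
which exist under S) and is NOT an item of this route (by name inside
D₅'s skeleton only). Given N11: S ⟺ P1 ∧ P2 ∧ J1 ∧ D₁ ∧ D₂ ∧ D₃ ∧ D₅ ∧ E₂⁽⁶⁾ mod S ⟹ P2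
(`node_iff`).
CROSS-ROUTE DIVIDEND. GaldiLiouvilleGate's compactness crux Z (0894) zooms at ENSTROPHY records (r_n
= ν²/Z) and is open on its thin-slow branch r_n ≪ ℓ; FRUGAL is
precisely r_n ≍ ℓ (μ_Z = ℓ/r_n up to constants): there the PACE zoom does Z's job with
non-triviality certified by 7781, so QZ is provable outright, and the LAVISH
residual E₂⁽⁶⁾ is Z's thin-slow branch seen from the vorticity side — one seam, two programmes (X2
shared by name, no new item).

PIECE TAGS (census HOME/census/COSTUME-CENSUS-v4.md sha256 e828b187… (final; critic row
2026-08-30T06:19:38Z); HOME/census/reconnect/j3378{78,80,82}/results.json (K9: μ_Z =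
Z/(ν^{3/2}W^{1/2}) at the ‖ω‖∞ peak 2.37e5 / 7.85e5 / 2.25e6 at Re 1000/2000/4000 — LAVISH,
recomputed by the critic), j338660 (K20), RECONNECT-PACE.md, FROZEN-INDEX.md; node card
HOME/decomp-ns-lens-2/NODE-g6.md sha256 0cabe9eabb6b546ad585… (191 lines); probes
HOME/decomp-ns-lens-2/bc/FrugalCoreProbe.lean → bc/FrugalCoreProbe.verdicts.txt (FrugalCoreExtends,
FrugalPaceZoom, EvanescentCoreExtends CLEAN [timeouts: P3]; TameLavishIsTypeI CLEAN; P5 C → S closed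
on none) — re-probed by the writer at batteryMs 90000 (frugal/bc/Probe.out.txt)).
- D₅ `FrugalCoreExtends` [crux r3 · NEW · WEAKER (than S: vacuity; than (L): kernel; than E₂⁗:
silent on lavish cores) · NOT IN PRINT (Gibbon's Regime II ∪ III at
  m = ∞ with arbitrary constant, ℝ³, Leray–Hopf) · Tao/NSI-free · ATTACKABLE NOW modulo 0893: BC3
skeleton `FrugalCoreExtends_of : FrugalPaceZoom →
  GaldiLiouvilleGate.ParabolicGaldiLiouville → FrugalCoreExtends` (QZ = FIRST PROVER TARGET,
theorem-in-waiting; X2 = shared hard core) · exposure = a backward DSS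
  Type-I profile with ∇U ∈ L² would refute X2 (and the proof, not necessarily the criterion)].
- E₂⁽⁶⁾ `TameLavishIsTypeI` [crux r2 · NEW · DECLARED RESIDUAL · WEAKER by restriction · STRICTLY
mod UNDECIDED separating class · LOADED with every printed/computed
  Type-II candidate (Gibbon's depleted Regime I) · IDEA-NEEDED · INSTRUMENTED (μ_Z = D_1/D_∞; census
columns requested) · never a prover target before an idea lands].
- StructuredCoresExtend [support · the born parent layer BY NAME (27619 ∧ 28713 ∧ 28714) · attacked
in N9/N11 (registered skeletons there) · closes by ⟨·,·,·⟩].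
- P1/P2/J1: verbatim (P1 the cell's BLOCKER 1217; P2 CKN-provable M; J1 N1's residual). Asides
(outside the cone, never staffed): QZ `FrugalPaceZoom` (D₅'s stub 1,
  FIRST PROVER TARGET — provers on D₅ land it `--supports`), R₅ `EvanescentCoreExtends` (rung of D₅,
X2-free expected theorem: the zoom limit has ZERO enstrophy ⟹
  constant slices vs 7781's non-constant slice).
- COSTUME: none (strip the vocabulary: D₅ is a conditional regularity criterion with a NEW
hypothesis — an integral budget of the whole flow in core units along pace
  records — proved modulo an EXISTING hard core; E₂⁽⁶⁾ is declared ≡ E₂⁗ minus exactly that cell;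
not g5's solitary cell (model-empty, critic row 56) — the frugal
  cell provably hosts Leray/DSS blobs with ∇U ∈ L²).
LEAF TAGS. ATTACKABLE NOW: QZ (compactness bookkeeping on landed 7781), R₅, the (L) → X2 edge
(PROVED, landable `--supports 0893`). IDEA-NEEDED: E₂⁽⁶⁾, X2 (shared).
INSTRUMENTABLE: T-frugal (μ_Z along vorticity records of a single-core collapse candidate; census
request (i)/(ii) of the card). BARRIER: E₂⁽⁶⁾ (Tao-LOADED), J1/P1 as in N1.

Rationale: WHY THIS LINE. N1 reduced Clay (A) to P1 ∧ P2 ∧ J1 ∧ E₂; lens-2 cut E₂ by CORE STRUCTURE — g2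
direction (D₁ coherent, N9), g3 line kinematics (D₂ columnar) and g4
depletion (D₃ frozen) (N11) — leaving E₂⁗ «tame LIVE-cored blow-ups are Type I» (28715); g5's
isolation cell was model-empty (critic OBJECTION row 56: «0 as a cut»,
repair menu (i) rate / (ii) tightness / (iii) instrument-first, (ii) pre-cleared). g6 files repair
(ii) in its sharp ε-free form: ENSTROPHY PACE. The special cell
(FRUGAL: the running enstrophy keeps pace with one core's budget ν^{3/2}W^{1/2}) is NOT model-empty
— backward self-similar / DSS blobs with ∇U ∈ L², fat-ring
collapse, paced cascades whose spent stages dissipate — and its tangent flows automatically carry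
FINITE ENSTROPHY and L⁶ slices, i.e. EXACTLY the hypothesis list
of the EXISTING parabolic Galdi–Liouville crux X2 (0893); so D₅ closes by the PROVED pace zoom
(7781) + bookkeeping (QZ) + X2 by name, with no new idea-needed leaf,
and the residual shrinks to LAVISH cores — where every printed and computed Type-II candidate
already sits (K9 μ_Z 2e5–2e6 ↑ with Re; Hou 2022; MK; KP; Tao; NSI).
LITERATURE DICTIONARY (exact): Gibbon's ladder D_m = (ϖ₀⁻¹Ω_m)^{α_m}, α_m = 2m/(4m−3) gives D_1 =
LZ/ν², D_∞ = LW^{1/2}ν^{−1/2}, so μ_Z = D_1/D_∞ (L cancels)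
[corpus:paper:arxiv-1402.1080 p.3 = Gibbon–Donzis–Gupta–Kerr–Pandit–Vincenzi, Nonlinearity 27 (2014)
2605; Gibbon arXiv:0905.0344]: the cut is the m = ∞ ENDPOINT of
their regime diagram — Regime III («very frugal», Ḋ_m ≤ 0, regular for 1 < m < ∞ on 𝕋³, «open
whether physical» p.4) = R₅'s territory; Regime II («frugal, not
small») «leads to no improvement» (p.4): NO METHOD IN PRINT = D₅ proper; Regime I (depletion, μ_Z →
∞) = LAVISH. Imported: blow-up compactness (KNSS / the tree's
pace zoom), Liouville theorems for ancient solutions (KNSS (L); Galdi's D-solution problem inside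
X2), Gibbon's moment ladder as the instrument. Sources:
HOME/decomp-ns-lens-2/FrugalCoreDichotomy.lean sha256
ea3efd4f1bd33822b969f1bea3ba90899fa1af2ad9e50aa411785f6edc582537 (1373 lines; lean rc 0 / 0 err / 0
warn / 0 sorry; axioms(closes*, node_iff, parabolicGaldiLiouville_of_liouville,
frugalPaceZoom_of_recordZoomAncient) standard — critic CRITIC-LEDGER row 2026-08-30T06:19:08Z
CLEARED); HOME/decomp-ns-lens-2/NODE-g6.md sha256 0cabe9eabb6b546ad585… (191 lines).
RANKED CRUXES. r2 E₂⁽⁶⁾ `TameLavishIsTypeI` (declared residual; hardest — no equation-level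
mechanism forces a lavish live core to be Type I; Tao-LOADED); r3 D₅
`FrugalCoreExtends` (attacked; first prover target QZ; closes modulo the shared hard core X2 0893);
r6 P2, r7 J1, r8 P1 (verbatim dedup); support StructuredCoresExtend
(D₁ ∧ D₂ ∧ D₃ by name, attacked in N9/N11).
KILL CRITERIA. D₅ refuted ⟺ a frugal-cored classical Leray–Hopf solution that blows up (a
single-core Type-II collapse with Z ≍ ν^{3/2}W^{1/2}, or a DSS Type-I blob —
the latter would also refute P1): kills D₅ and, through QZ (theorem-grade), exhibits a nontrivial
finite-enstrophy L⁶ bounded ancient flow, i.e. refutes X2 0893 and (L)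
10551 with it — informative either way. E₂⁽⁶⁾ refuted-substantive: a tame lavish Type-II blow-up
(K9-type tube pair or Hou ring-sheet made exact) — kills E₂⁗, E₂″, E₂
and N1's line. QZ cannot be refuted without refuting 7781's frame (it is WEAKER than 0894 and
S-necessary). COLLAPSE: none new — D₅'s only non-(L) content is QZ
(compactness); if X2 is refuted the criterion D₅ survives as a statement but loses its proof (re-tag
IDEA-NEEDED).
NOT DECOMPOSED YET. E₂⁽⁶⁾ (declared residual; census sub-cells E₆ˢ paced-lavish / E₆ᵇ
ballistic-lavish = E₄ᵇ = E₃ᵇ recorded in the lens, not filed); X2 (the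
GaldiLiouvilleGate's own ladder: CriticalRateLiouville 0897 PROVED, Galdi X_G 0895, thin-slow
branch); QZ's two passengers (Fatou for fderiv under the KNSS extraction;
Sobolev + weak lsc) are prover-level lemmas `--supports`, never items; P2/J1/P1 laddered in N1's
lineage.
CHEAPEST FALSIFIER. In-Lean (this filing): the skeleton kernel `FrugalCoreExtends_of :
FrugalPaceZoom → GaldiLiouvilleGate.ParabolicGaldiLiouville → FrugalCoreExtends`
type-checks QZ's inlined frugal-ancient interface against the tree's 0893 BY NAME, and the rung
`FrugalCoreExtends_rung` (PROVED: a frugal-cored maximal solution has a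
NONTRIVIAL bounded ancient mild tangent flow — lens `hasPaceWitness_of_isFrugalCore` + landed 7781)
exercises the lever unconditionally. Census (≤ 1 core-h, existing
fields): T-frugal — μ_Z(t) and its core share along the vorticity records of K9/K13/K14/K20
(prediction: lavish, growing like L/ℓ) and of any single-core collapse
control run (prediction: O(1), regular); a bounded-μ_Z run that blows up numerically would put D₅
under suspicion. Literature: a printed regularity criterion of D₅'s
shape (Regime II at m = ∞) or a Liouville theorem of X2's shape re-grades D₅/X2 to citations.

Novelty: Searches (lens-2 g6 2026-08-30, both corpora; re-read by the writer): cell — no other lens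
conditions on an INTEGRAL BUDGET of the whole flow measured in core units
(lens-1 rate / LP thinness / chirality; lens-3 trace / germ; lens-4 datum / marginal rate /
threshold saddle; lens-5 symmetry / Reynolds horizon Re_core = VELOCITY pace;
lens-6 LOCAL parabolic budget r⁻¹∫_{B_r}|u|² at a vertex / dark balls; lens-2 g2 direction, g3
line-invariance, g4 depletion, g5 isolation); born N1–N16 read.
Tree: `rg -l frobeniusNormSq Summits/…/Theses/` → GaldiLiouvilleGate (0893/0894: enstrophy-RECORD
zoom along one solution, every blow-up), TypeIQuarterGate,
EnstrophyDefect-type files — none types Z against ‖ω‖∞^{1/2} along PACE records or books the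
complement as a residual; nearest = 0894 (delta: zoom at pace records
inside a declared cell where non-triviality is free and finite enstrophy is inherited; QZ ⟸ 0894 in
kernel). Corpus: `lit search --hybrid "enstrophy bounded by square
root of vorticity maximum blow-up criterion"` → ladder generalities [corpus:doering-gibbon1995
pp.93–94], [corpus:foias-manley-rosa-temam2001], [corpus:lemarie-
rieusset2016 p.368]; `lit search --hybrid "Liouville bounded ancient solution finite enstrophy"` →
[corpus:book:seregin2014 p.114 Thm 4.12] (finite LPS M_{s,l},
l < ∞; in tree as AncientLPSLiouvilleMild; does NOT cover X2's L^∞_s L⁶) and p.113 Conjecture (L);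
`lit vsearch "<frugal criterion in prose>"` → [corpus:book:
robinson2016 p.170 §12.3 BKM], Majda–B  [refs: math/0612425, book:seregin2014, paper:arxiv-1402.1080]

Barriers (technique_class: frugal-lavish dichotomy; pace zoom; Dirichlet-tangent rigid): - technique_class: frugal-lavish dichotomy; pace zoom; Dirichlet-tangent rigid (blow-up compactness
at pace records + an imported parabolic Liouville leaf for
  finite-enstrophy L⁶ ancient flows; conditional criterion D₅; a-priori structure claim E₂⁽⁶⁾
declared residual).
- KNSS bounded-ancient Liouville OPEN in 3-D ((L) 10551; no catalogued barrier decl, the tree's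
VorticityPace crux): D₅ and X2 are INSIDE (L)'s cone in kernel; X2 is
  (L) restricted to finite-enstrophy L⁶ flows; QZ uses only landed theorems. Honest: X2 contains
Leray's bounded D-solution problem (0895) — the bet of the
  GaldiLiouvilleGate route, shared here by name, not duplicated.
- Literature.Barriers.NavierStokesRegularity.TaoAveragedBlowup: the averaged cascade is multi-scale
with undissipated spent stages and ballistic — LAVISH, inside
  E₂⁽⁶⁾ (its ballistic sub-cell), DECLARED LOADED, no evasion claimed (any proof of E₂⁽⁶⁾ must use
the exact u·∇u algebra); D₅/QZ/X2 are NS-specific (Oseen-mild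
  structure, KNSS smoothing, Liouville-grade rigidity) with no averaged analogue — outside the class
for the special cell.
- Literature.Barriers.NavierStokesRegularity.AveragedTypeIBlowup / EnergySupercriticality: D₅/QZ use
the energy class only through H¹ slices (Sobolev passenger); the
  deciding input is a Liouville problem, not an a-priori supercritical estimate: outside. E₂⁽⁶⁾
INSIDE only in that no energy-class argument proves it (declared
  IDEA-NEEDED, residual).
- Literature.Barriers.NavierStokesRegular

History (route lifecycle, newest last):
- 2026-08-30T10:22:12Z · rev 2: informal re-worded for TameLavishIsTypeI_of_cells (planner-decomp-ns-writer-1-g4-0)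

sub-problem: NavierStokesRegularity · status: draft · opened planner-decomp-ns-writer-1-g3-0 2026-08-30T06:51:19Z · rev 2 · ledger route-NavierStokesRegularity-RootDecompFrugalCore
GENERATED by the gate from the ledger (D-0016/17). Provers cite these decls: `theorem foo : Summit.NavierStokesRegularity.NavierStokesRegularity.Theses.RootDecompFrugalCore.<Decl> := …` in Summits/NavierStokesRegularity/NavierStokesRegularity/Theorems/<Name>.lean.
-/

namespace Summit.NavierStokesRegularity.NavierStokesRegularity.Theses.RootDecompFrugalCore

open scoped BigOperators Topology Manifold Classical MeasureTheory ProbabilityTheory Matrix InnerProductSpace ComplexConjugate ContinuousMap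
open Filter Set Function TopologicalSpace MeasureTheory

attribute [summit_statement] _root_.NavierStokesRegularity

open Literature.NS

/-- item stmt-NavierStokesRegularity-29703 · crux · rank 2 · SPLIT (gen 1) into TameLavishRoundIsTypeI, TameLavishSkewIsTypeI + glue TameLavishIsTypeI_of_cells · direct attempts still welcome (low priority) · by planner
why it might fail: a tame lavish Type-II blow-up — an anti-parallel tube pair (K9-type, μ_Z ≍ L/ℓ → ∞) or Hou's ring-sheet made exact — is tame, live, lavish and not Type I; Tao's averaged cascade is a lavish model
sources: arXiv:1402.0290, arXiv:1402.1080, Hou2022, MoffattKimura2019, arXiv:0709.3599, KochNadirashviliSereginSverak2009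
[crux] E₂⁽⁶⁾ TAME LAVISH-CORED BLOW-UPS ARE TYPE I (lens-2 g6; node N17 under N11's residual E₂⁗ =
RootDecompCoreDynamics.TameLiveIsTypeI stmt-28715; DECLARED RESIDUAL): a maximal smooth solution
with lifespan T, Leray–Hopf from a rapidly decaying datum, TAME at T, whose core is LIVE (neither
coherent, columnar nor frozen — N11's clauses verbatim) and LAVISH (for every C, M the pace records
near T sit above an enstrophy surplus ∫|∇u(s)|² > M√(1+|ω(t,y)|) somewhere in their past; in
particular every ballistic core) is Type I [tag WEAKER than E₂⁗ by restriction (kernel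
`tameLavish_of_tameLive`); STRICTLY mod the UNDECIDED separating class «tame frugal-cored Type-II
collapse» · LOADED (declared) with every printed/computed Type-II candidate: K9 μ_Z 2e5–2e6 ↑, Hou
2022, Moffatt–Kimura, Kang–Protas, thin rings, Tao cascades, NSI pastings · IDEA-NEEDED ·
INSTRUMENTED (μ_Z = Gibbon D_1/D_∞) · never a prover target before an idea lands] -/
@[route_item "route-NavierStokesRegularity-RootDecompFrugalCore", crux]
def TameLavishIsTypeI : Prop :=
  ∀ (ν T : ℝ), 0 < ν → 0 < T → ∀ (u : ℝ → EuclideanSpace ℝ (Fin 3) → EuclideanSpace ℝ (Fin 3)) (p : ℝ → EuclideanSpace ℝ (Fin 3) → ℝ), Literature.Analysis.FluidPDE.IsMaximalSmoothSolution ν 0 u p T → Literature.Analysis.FluidPDE.IsLerayHopfOn T ν 0 (u 0) u → Literature.Analysis.FluidPDE.HasRapidSpatialDecay (u 0) → Filter.Tendsto (fun t => MeasureTheory.eLpNorm (u t - u T) 2 MeasureTheory.volume) (nhdsWithin T (Set.Iio T)) (nhds 0) → ¬ ((∃ d : ℝ, 0 < d ∧ (∀ ε : ℝ, 0 < ε →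 ∃ δ : ℝ, 0 < δ ∧ ∀ t ∈ Set.Ico 0 T, ∀ x y : EuclideanSpace ℝ (Fin 3), d < ‖Literature.Analysis.FluidPDE.curl (u t) x‖ → d < ‖Literature.Analysis.FluidPDE.curl (u t) y‖ → ‖x - y‖ < δ → Real.sqrt (1 - (inner ℝ (‖Literature.Analysis.FluidPDE.curl (u t) x‖⁻¹ • Literature.Analysis.FluidPDE.curl (u t) x) (‖Literature.Analysis.FluidPDE.curl (u t) y‖⁻¹ • Literature.Analysis.FluidPDE.curl (u t) y)) ^ 2) ≤ ε)) ∧ (∃ C : ℝ, ∀ t₀ ∈ Set.Ico 0 T, ∃ t ∈ Set.Ico t₀ T, ∀ s ∈ Set.Icc 0 t, ∀ x : EuclideanSpace ℝ (Fin 3), ∃ y : EuclideanSpace ℝ (Fin 3), ‖u s x‖ ^ 2 ≤ C * (1 + ‖Literature.Analysis.FluidPDE.curl (u t) y‖))) → ¬ (∃ C : ℝ, ∀ A ε : ℝ, 0 < A → 0 < ε → ∀ t₀ ∈ Set.Ico 0 T, ∃ t ∈ Set.Ico t₀ T, ∃ y : EuclideanSpace ℝ (Fin 3), (∀ s ∈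 Set.Icc 0 t, ∀ x : EuclideanSpace ℝ (Fin 3), ‖u s x‖ ^ 2 ≤ C * (1 + ‖Literature.Analysis.FluidPDE.curl (u t) y‖)) ∧ ∃ e : EuclideanSpace ℝ (Fin 3), ‖e‖ = 1 ∧ ∀ s ∈ Set.Icc 0 t, t - A / (1 + ‖Literature.Analysis.FluidPDE.curl (u t) y‖) ≤ s → ∀ x : EuclideanSpace ℝ (Fin 3), ‖x - y‖ ≤ A / Real.sqrt (1 + ‖Literature.Analysis.FluidPDE.curl (u t) y‖) → ‖fderiv ℝ (u s) x e‖ ≤ ε * (1 + ‖Literature.Analysis.FluidPDE.curl (u t) y‖)) → ¬ (∃ C : ℝ, ∀ A ε : ℝ, 0 < A → 0 < ε → ∀ t₀ ∈ Set.Ico 0 T, ∃ t ∈ Set.Ico t₀ T, ∃ y : EuclideanSpace ℝ (Fin 3), (∀ s ∈ Set.Icc 0 t, ∀ x : EuclideanSpace ℝ (Fin 3), ‖u s x‖ ^ 2 ≤ C * (1 + ‖Literature.Analysis.FluidPDE.curl (u t) y‖)) ∧ ∃ c : EuclideanSpace ℝ (Fin 3), ‖c‖ ^ 2 ≤ C *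 (1 + ‖Literature.Analysis.FluidPDE.curl (u t) y‖) ∧ ∀ s ∈ Set.Icc 0 t, t - A / (1 + ‖Literature.Analysis.FluidPDE.curl (u t) y‖) ≤ s → ∀ x : EuclideanSpace ℝ (Fin 3), ‖x - y‖ ≤ A / Real.sqrt (1 + ‖Literature.Analysis.FluidPDE.curl (u t) y‖) → ‖Literature.Analysis.FluidPDE.curl (fun z => Literature.Analysis.FluidPDE.cross (Literature.Analysis.FluidPDE.curl (u s) z) (u s z - c)) x‖ ≤ ε * (1 + ‖Literature.Analysis.FluidPDE.curl (u t) y‖) ^ 2) → ¬ (∃ C M : ℝ, ∀ t₀ ∈ Set.Ico 0 T, ∃ t ∈ Set.Ico t₀ T, ∃ y : EuclideanSpace ℝ (Fin 3), (∀ s ∈ Set.Icc 0 t, ∀ x : EuclideanSpace ℝ (Fin 3), ‖u s x‖ ^ 2 ≤ C * (1 + ‖Literature.Analysis.FluidPDE.curl (u t) y‖)) ∧ ∀ s ∈ Set.Icc 0 t, ∫⁻ x, ENNReal.ofReal (Literature.Analysis.FluidPDE.frobeniusNormSq (fderiv ℝ (u s) x)) ≤ ENNReal.ofReal (M * Real.sqrt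 (1 + ‖Literature.Analysis.FluidPDE.curl (u t) y‖))) → Literature.Analysis.FluidPDE.IsTypeIBlowup u T

-- parent: TameLavishIsTypeI · child (gen 1)
/--     item stmt-NavierStokesRegularity-32092 · crux · rank 201 · open
    parent: TameLavishIsTypeI · by planner
    why it might fail: Only through AxL♯: a bounded ancient axisymmetric mild solution WITH unbounded swirl and a non-constant slice (KNSS's open case) arising as the tangent flow of a round core would make R₉ false as a Type-I claim; AZ itself is compactness (size risk only).
    sources: arXiv:0709.3599, KochNadirashviliSereginSverak2009, arXiv:1908.11591, arXiv:2101.04905, Hou2022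
[crux · R₉ «A TAME LIVE LAVISH ROUND-CORED BLOW-UP IS TYPE I» · NEW SPECIAL CELL · child 1 of the
GLUED SPLIT (gen 1) of E₂⁽⁶⁾ `TameLavishIsTypeI` stmt-NavierStokesRegularity-29703 (N17
`RootDecompFrugalCore` crux r2 = DECLARED RESIDUAL of record, never refined) = lens-2 g9 «THE ROUND
CORE» (HOME/decomp-ns-lens-2/RoundCoreDichotomy.lean sha256 d78be15d…, 955 lines, lean rc 0 / 0
sorry, axioms std; NODE-g9.md; CRITIC-LEDGER row 105 CLEARED, «prefer g9 over g8»): E₂⁽⁶⁾ ⟺ R₉ ∧ G₉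
EXACT in kernel (`tameLavish_iff_cells9`, excluded middle on the ROUND-CORE predicate IsRoundCore T
u := ∃ C ∀ A ε > 0, cofinally in t ↑ T a pace-level point y, a unit axis e and an axis point c
within C/√(1+W) of y (W = |ω(t,y)|) such that on the parabolic window of A core units the AXIAL
LIE-DERIVATIVE DEFECT ‖Du(s,x)[e × (x − c)] − e × u(s,x)‖ ≤ ε√(1+W) — some tangent flow at a paced
core point is axisymmetric about an axis at bounded distance). R₉ = the parent's frame (maximal
smooth LH solution from a rapidly decaying datum, TAME at T, core LIVE = not
coherent/columnar/frozen, LAVISH = not frugal) + IsRoundCore T u ⟹ Type I. Tags: WEAKER than 29703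
(restriction, kernel `tameLavishRound_of_frugalCoreResid -/
@[route_item "route-NavierStokesRegularity-RootDecompFrugalCore"]
def TameLavishRoundIsTypeI : Prop :=
  ∀ (ν T : ℝ), 0 < ν → 0 < T → ∀ (u : ℝ → EuclideanSpace ℝ (Fin 3) → EuclideanSpace ℝ (Fin 3)) (p : ℝ → EuclideanSpace ℝ (Fin 3) → ℝ), Literature.Analysis.FluidPDE.IsMaximalSmoothSolution ν 0 u p T → Literature.Analysis.FluidPDE.IsLerayHopfOn T ν 0 (u 0) u → Literature.Analysis.FluidPDE.HasRapidSpatialDecay (u 0) → Filter.Tendsto (fun t => MeasureTheory.eLpNorm (u t - u T) 2 MeasureTheory.volume) (nhdsWithin T (Set.Iio T)) (nhds 0) → ¬ ((∃ d : ℝ, 0 < d ∧ (∀ ε : ℝ, 0 < ε → ∃ δ : ℝ, 0 < δ ∧ ∀ t ∈ Set.Ico 0 T, ∀ x y : EuclideanSpace ℝ (Fin 3), d < ‖Literature.Analysis.FluidPDE.curl (u t) x‖ → d < ‖Literature.Analysis.FluidPDE.curl (u t) y‖ → ‖x - y‖ < δ → Real.sqrt (1 - (inner ℝ (‖Literature.Analysis.FluidPDE.curl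 (u t) x‖⁻¹ • Literature.Analysis.FluidPDE.curl (u t) x) (‖Literature.Analysis.FluidPDE.curl (u t) y‖⁻¹ • Literature.Analysis.FluidPDE.curl (u t) y)) ^ 2) ≤ ε)) ∧ (∃ C : ℝ, ∀ t₀ ∈ Set.Ico 0 T, ∃ t ∈ Set.Ico t₀ T, ∀ s ∈ Set.Icc 0 t, ∀ x : EuclideanSpace ℝ (Fin 3), ∃ y : EuclideanSpace ℝ (Fin 3), ‖u s x‖ ^ 2 ≤ C * (1 + ‖Literature.Analysis.FluidPDE.curl (u t) y‖))) → ¬ (∃ C : ℝ, ∀ A ε : ℝ, 0 < A → 0 < ε → ∀ t₀ ∈ Set.Ico 0 T, ∃ t ∈ Set.Ico t₀ T, ∃ y : EuclideanSpace ℝ (Fin 3), (∀ s ∈ Set.Icc 0 t, ∀ x : EuclideanSpace ℝ (Fin 3), ‖u s x‖ ^ 2 ≤ C * (1 + ‖Literature.Analysis.FluidPDE.curl (u t) y‖)) ∧ ∃ e : EuclideanSpace ℝ (Fin 3), ‖e‖ = 1 ∧ ∀ s ∈ Set.Icc 0 t, t - A / (1 + ‖Literature.Analysis.FluidPDE.curl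 (u t) y‖) ≤ s → ∀ x : EuclideanSpace ℝ (Fin 3), ‖x - y‖ ≤ A / Real.sqrt (1 + ‖Literature.Analysis.FluidPDE.curl (u t) y‖) → ‖fderiv ℝ (u s) x e‖ ≤ ε * (1 + ‖Literature.Analysis.FluidPDE.curl (u t) y‖)) → ¬ (∃ C : ℝ, ∀ A ε : ℝ, 0 < A → 0 < ε → ∀ t₀ ∈ Set.Ico 0 T, ∃ t ∈ Set.Ico t₀ T, ∃ y : EuclideanSpace ℝ (Fin 3), (∀ s ∈ Set.Icc 0 t, ∀ x : EuclideanSpace ℝ (Fin 3), ‖u s x‖ ^ 2 ≤ C * (1 + ‖Literature.Analysis.FluidPDE.curl (u t) y‖)) ∧ ∃ c : EuclideanSpace ℝ (Fin 3), ‖c‖ ^ 2 ≤ C * (1 + ‖Literature.Analysis.FluidPDE.curl (u t) y‖) ∧ ∀ s ∈ Set.Icc 0 t, t - A / (1 + ‖Literature.Analysis.FluidPDE.curl (u t) y‖) ≤ s → ∀ x : EuclideanSpace ℝ (Fin 3), ‖x - y‖ ≤ A / Real.sqrt (1 + ‖Literature.Analysis.FluidPDE.curl (u t) y‖) → ‖Literature.Analysis.FluidPDE.curl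 (fun z => Literature.Analysis.FluidPDE.cross (Literature.Analysis.FluidPDE.curl (u s) z) (u s z - c)) x‖ ≤ ε * (1 + ‖Literature.Analysis.FluidPDE.curl (u t) y‖) ^ 2) → ¬ (∃ C M : ℝ, ∀ t₀ ∈ Set.Ico 0 T, ∃ t ∈ Set.Ico t₀ T, ∃ y : EuclideanSpace ℝ (Fin 3), (∀ s ∈ Set.Icc 0 t, ∀ x : EuclideanSpace ℝ (Fin 3), ‖u s x‖ ^ 2 ≤ C * (1 + ‖Literature.Analysis.FluidPDE.curl (u t) y‖)) ∧ ∀ s ∈ Set.Icc 0 t, ∫⁻ x, ENNReal.ofReal (Literature.Analysis.FluidPDE.frobeniusNormSq (fderiv ℝ (u s) x)) ≤ ENNReal.ofReal (M * Real.sqrt (1 + ‖Literature.Analysis.FluidPDE.curl (u t) y‖))) → (∃ C : ℝ, ∀ A ε : ℝ, 0 < A → 0 < ε → ∀ t₀ ∈ Set.Ico 0 T, ∃ t ∈ Set.Ico t₀ T, ∃ y : EuclideanSpace ℝ (Fin 3), (∀ s ∈ Set.Icc 0 t, ∀ x : EuclideanSpace ℝ (Fin 3), ‖u s x‖ ^ 2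 ≤ C * (1 + ‖Literature.Analysis.FluidPDE.curl (u t) y‖)) ∧ ∃ e c : EuclideanSpace ℝ (Fin 3), ‖e‖ = 1 ∧ ‖c - y‖ ≤ C / Real.sqrt (1 + ‖Literature.Analysis.FluidPDE.curl (u t) y‖) ∧ ∀ s ∈ Set.Icc 0 t, t - A / (1 + ‖Literature.Analysis.FluidPDE.curl (u t) y‖) ≤ s → ∀ x : EuclideanSpace ℝ (Fin 3), ‖x - y‖ ≤ A / Real.sqrt (1 + ‖Literature.Analysis.FluidPDE.curl (u t) y‖) → ‖fderiv ℝ (u s) x (Literature.Analysis.FluidPDE.cross e (x - c)) - Literature.Analysis.FluidPDE.cross e (u s x)‖ ≤ ε * Real.sqrt (1 + ‖Literature.Analysis.FluidPDE.curl (u t) y‖)) → Literature.Analysis.FluidPDE.IsTypeIBlowup u T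

-- parent: TameLavishIsTypeI · child (gen 1)
/--     item stmt-NavierStokesRegularity-32093 · crux · rank 202 · open
    parent: TameLavishIsTypeI · by planner
    why it might fail: A skew tame live lavish Type-II blow-up — Kerr-type anti-parallel tubes, a Moffatt–Kimura tent or a ring-collision cascade made exact, or a ballistic Tao-type cascade realised by NS — violates it; nothing in print constrains the skew ballistic class.
    sources: MoffattKimura2019, Hou2022, Tao2016AveragedNS, arXiv:1402.0290, arXiv:0709.3599
[crux · G₉ «A TAME LIVE LAVISH SKEW-CORED BLOW-UP IS TYPE I» · NEW · DECLARED RESIDUAL of the node ·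
child 2 of the GLUED SPLIT (gen 1) of E₂⁽⁶⁾ `TameLavishIsTypeI` stmt-NavierStokesRegularity-29703 =
lens-2 g9 «THE ROUND CORE» (RoundCoreDichotomy.lean d78be15d…; CRITIC-LEDGER row 105): the parent's
frame + ¬ IsRoundCore T u («SKEW core»: no tangent flow at a paced core point has a continuous
rotational symmetry) ⟹ Type I. Tags: WEAKER than 29703 (restriction, kernel
`tameLavishSkew_of_frugalCoreResidual`) and than S (vacuity `tameLavishSkew_of_root`); STRICTLY mod
the UNDECIDED class {round tame live lavish Type II} (engine-closed mod AZ ∧ AxL♯; model-inhabited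
by Hou up to a log); MODEL-LOADED (Kerr anti-parallel tubes, Moffatt–Kimura tent, Kida–Pelz,
ring-collision elliptic cascades, Tao cascades); census refinement in kernel G₉ ⟺ G₉ᵖ ∧ G₉ᵇ
(`tameLavishSkew_iff_paceCells`), G₉ᵖ (paced skew) ⟸ (L) 10551 (`tamePacedLavishSkew_of_liouville`,
PROVED 7781), G₉ᵇ (ballistic skew) ⟸ census cell (b) TameBallisticLavishIsTypeI (restriction —
nothing new claimed on ballistic cores); ¬K-form G₉⁽⁸⁾ WEAKER than g8's G₈ and than N2's 25380
OffAxisNoBlowup (kernel). IDEA-NEEDED (next stabilizer -/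
@[route_item "route-NavierStokesRegularity-RootDecompFrugalCore"]
def TameLavishSkewIsTypeI : Prop :=
  ∀ (ν T : ℝ), 0 < ν → 0 < T → ∀ (u : ℝ → EuclideanSpace ℝ (Fin 3) → EuclideanSpace ℝ (Fin 3)) (p : ℝ → EuclideanSpace ℝ (Fin 3) → ℝ), Literature.Analysis.FluidPDE.IsMaximalSmoothSolution ν 0 u p T → Literature.Analysis.FluidPDE.IsLerayHopfOn T ν 0 (u 0) u → Literature.Analysis.FluidPDE.HasRapidSpatialDecay (u 0) → Filter.Tendsto (fun t => MeasureTheory.eLpNorm (u t - u T) 2 MeasureTheory.volume) (nhdsWithin T (Set.Iio T)) (nhds 0) → ¬ ((∃ d : ℝ, 0 < d ∧ (∀ ε : ℝ, 0 < ε → ∃ δ : ℝ, 0 < δ ∧ ∀ t ∈ Set.Ico 0 T, ∀ x y : EuclideanSpace ℝ (Fin 3), d < ‖Literature.Analysis.FluidPDE.curl (u t) x‖ → d < ‖Literature.Analysis.FluidPDE.curl (u t) y‖ → ‖x - y‖ < δ → Real.sqrt (1 - (inner ℝ (‖Literature.Analysis.FluidPDE.curl (u t) x‖⁻¹ • Literature.Analysis.FluidPDE.curl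 (u t) x) (‖Literature.Analysis.FluidPDE.curl (u t) y‖⁻¹ • Literature.Analysis.FluidPDE.curl (u t) y)) ^ 2) ≤ ε)) ∧ (∃ C : ℝ, ∀ t₀ ∈ Set.Ico 0 T, ∃ t ∈ Set.Ico t₀ T, ∀ s ∈ Set.Icc 0 t, ∀ x : EuclideanSpace ℝ (Fin 3), ∃ y : EuclideanSpace ℝ (Fin 3), ‖u s x‖ ^ 2 ≤ C * (1 + ‖Literature.Analysis.FluidPDE.curl (u t) y‖))) → ¬ (∃ C : ℝ, ∀ A ε : ℝ, 0 < A → 0 < ε → ∀ t₀ ∈ Set.Ico 0 T, ∃ t ∈ Set.Ico t₀ T, ∃ y : EuclideanSpace ℝ (Fin 3), (∀ s ∈ Set.Icc 0 t, ∀ x : EuclideanSpace ℝ (Fin 3), ‖u s x‖ ^ 2 ≤ C * (1 + ‖Literature.Analysis.FluidPDE.curl (u t) y‖)) ∧ ∃ e : EuclideanSpace ℝ (Fin 3), ‖e‖ = 1 ∧ ∀ s ∈ Set.Icc 0 t, t - A / (1 + ‖Literature.Analysis.FluidPDE.curl (u t) y‖) ≤ s → ∀ x : EuclideanSpace ℝ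 (Fin 3), ‖x - y‖ ≤ A / Real.sqrt (1 + ‖Literature.Analysis.FluidPDE.curl (u t) y‖) → ‖fderiv ℝ (u s) x e‖ ≤ ε * (1 + ‖Literature.Analysis.FluidPDE.curl (u t) y‖)) → ¬ (∃ C : ℝ, ∀ A ε : ℝ, 0 < A → 0 < ε → ∀ t₀ ∈ Set.Ico 0 T, ∃ t ∈ Set.Ico t₀ T, ∃ y : EuclideanSpace ℝ (Fin 3), (∀ s ∈ Set.Icc 0 t, ∀ x : EuclideanSpace ℝ (Fin 3), ‖u s x‖ ^ 2 ≤ C * (1 + ‖Literature.Analysis.FluidPDE.curl (u t) y‖)) ∧ ∃ c : EuclideanSpace ℝ (Fin 3), ‖c‖ ^ 2 ≤ C * (1 + ‖Literature.Analysis.FluidPDE.curl (u t) y‖) ∧ ∀ s ∈ Set.Icc 0 t, t - A / (1 + ‖Literature.Analysis.FluidPDE.curl (u t) y‖) ≤ s → ∀ x : EuclideanSpace ℝ (Fin 3), ‖x - y‖ ≤ A / Real.sqrt (1 + ‖Literature.Analysis.FluidPDE.curl (u t) y‖) → ‖Literature.Analysis.FluidPDE.curl (fun z => Literature.Analysis.FluidPDE.cross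 (Literature.Analysis.FluidPDE.curl (u s) z) (u s z - c)) x‖ ≤ ε * (1 + ‖Literature.Analysis.FluidPDE.curl (u t) y‖) ^ 2) → ¬ (∃ C M : ℝ, ∀ t₀ ∈ Set.Ico 0 T, ∃ t ∈ Set.Ico t₀ T, ∃ y : EuclideanSpace ℝ (Fin 3), (∀ s ∈ Set.Icc 0 t, ∀ x : EuclideanSpace ℝ (Fin 3), ‖u s x‖ ^ 2 ≤ C * (1 + ‖Literature.Analysis.FluidPDE.curl (u t) y‖)) ∧ ∀ s ∈ Set.Icc 0 t, ∫⁻ x, ENNReal.ofReal (Literature.Analysis.FluidPDE.frobeniusNormSq (fderiv ℝ (u s) x)) ≤ ENNReal.ofReal (M * Real.sqrt (1 + ‖Literature.Analysis.FluidPDE.curl (u t) y‖))) → ¬ (∃ C : ℝ, ∀ A ε : ℝ, 0 < A → 0 < ε → ∀ t₀ ∈ Set.Ico 0 T, ∃ t ∈ Set.Ico t₀ T, ∃ y : EuclideanSpace ℝ (Fin 3), (∀ s ∈ Set.Icc 0 t, ∀ x : EuclideanSpace ℝ (Fin 3), ‖u s x‖ ^ 2 ≤ C * (1 + ‖Literature.Analysis.FluidPDE.curl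 (u t) y‖)) ∧ ∃ e c : EuclideanSpace ℝ (Fin 3), ‖e‖ = 1 ∧ ‖c - y‖ ≤ C / Real.sqrt (1 + ‖Literature.Analysis.FluidPDE.curl (u t) y‖) ∧ ∀ s ∈ Set.Icc 0 t, t - A / (1 + ‖Literature.Analysis.FluidPDE.curl (u t) y‖) ≤ s → ∀ x : EuclideanSpace ℝ (Fin 3), ‖x - y‖ ≤ A / Real.sqrt (1 + ‖Literature.Analysis.FluidPDE.curl (u t) y‖) → ‖fderiv ℝ (u s) x (Literature.Analysis.FluidPDE.cross e (x - c)) - Literature.Analysis.FluidPDE.cross e (u s x)‖ ≤ ε * Real.sqrt (1 + ‖Literature.Analysis.FluidPDE.curl (u t) y‖)) → Literature.Analysis.FluidPDE.IsTypeIBlowup u T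

-- parent: TameLavishIsTypeI · glue (gen 1)
/--     item stmt-NavierStokesRegularity-32094 · support · rank 203 · closed · proved by Summit.NavierStokesRegularity.NavierStokesRegularity.Theorems.FrugalCore.tameLavishIsTypeI_of_cells_proof (prover)
    parent: TameLavishIsTypeI · GLUE: children ⟹ parent · by planner
lens-2 g9 «THE ROUND CORE» (CRITIC-LEDGER row 105 CLEARED;
HOME/decomp-ns-lens-2/RoundCoreDichotomy.lean sha256 d78be15d…, rc 0 / 0 sorry): E₂⁽⁶⁾
TameLavishIsTypeI (29703, N17 residual of record) ⟺ R₉ ∧ G₉ EXACT in kernel (tameLavish_iff_cells9;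
excluded middle on the round-core predicate IsRoundCore T u = asymptotic rotational symmetry of a
tangent flow at a paced core point; writer Sketch TameLavishIsTypeI_of_cells via Classical.em, rc
0). R₉ TameLavishRoundIsTypeI = special cell, CLOSED mod the engine AZ RoundPaceZoom ∧ AxL♯
AxisymmetricAncientLiouville (tameLavishRound_of) and mod (L) alone; G₉ TameLavishSkewIsTypeI =
declared residual. N17 closes re-run through the cells: closes9_via_N17 (P1 P2 J1 SCE D₅ R₉ G₉ → S).
Supports filed: AZ RoundPaceZoom stmt-NavierStokesRegularity-32101 (FIRST PROVER TARGET), AxL♯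
AxisymmetricAncientLiouville 32102 (engine, named open problem, S-free), R₉⁰
TameLavishSwirlFreeRoundIsTypeI 32103 (BC5 rung, theorem-grade mod AZ⁰). Evidence file
roundcore/GlueProofN17E.lean (lens VERBATIM + writer § RoundGlue: glue_holds, iff, closes_via_split,
R₉ ⟸ AZ ∧ AxL♯, R₉⁰ ⟸ AZ⁰, (L) ⟹ AxL♯ ⟹ (AX-L)). -/
@[route_item "route-NavierStokesRegularity-RootDecompFrugalCore"]
def TameLavishIsTypeI_of_cells : Prop :=
  TameLavishRoundIsTypeI → TameLavishSkewIsTypeI → TameLavishIsTypeI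

-- `TameLavishIsTypeI_of_cells` holds: proved by `Summit.NavierStokesRegularity.NavierStokesRegularity.Theorems.FrugalCore.tameLavishIsTypeI_of_cells_proof` (its module imports this route file, so no `_holds` link can be stated here).

/-- item stmt-NavierStokesRegularity-29704 · crux · rank 3 · open · by planner
why it might fail: only through X2: a nontrivial bounded ancient finite-enstrophy L⁶ mild solution (e.g. a backward DSS Type-I profile with ∇U ∈ L²) refutes X2 and with it this proof — and, if it arises as a tangent flow, the criterion
sources: arXiv:1402.1080, arXiv:0905.0344, KochNadirashviliSereginSverak2009, Galdi2011, Seregin2014, arXiv:0709.3599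
[crux] D₅ FRUGAL CORES EXTEND (lens-2 g6; NEW; the ATTACKED conjunct): a classical NS solution on
[0,T), Leray–Hopf from a rapidly decaying datum, whose core is FRUGAL (∃ C M: cofinally in t ↑ T a
pace record (t,y) — |u(s,x)|² ≤ C(1+|ω(t,y)|) on [0,t]×ℝ³ — below which the running enstrophy
satisfies ∫|∇u(s)|² ≤ M√(1+|ω(t,y)|) for all s ≤ t; Gibbon's D_1 ≤ M'D_∞ along records, Regimes II ∪
III at m = ∞) extends smoothly past T [tag WEAKER than S (vacuity), than (L) 10551 (kernel via
PROVED 7781), than E₂⁗ (silent on lavish cores) · NOT IN PRINT · Tao/NSI-free · ATTACKABLE NOW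
modulo the EXISTING hard core X2 = GaldiLiouvilleGate.ParabolicGaldiLiouville 0893 (BY NAME): BC3
skeleton FrugalCoreExtends_of : FrugalPaceZoom → ParabolicGaldiLiouville → FrugalCoreExtends; FIRST
PROVER TARGET = the aside QZ FrugalPaceZoom (7781 at frugal records + Fatou/Sobolev passengers +
knss2009_smoothing_holds); PROVED edge (L) → X2 re-checked in the skeleton] -/
@[route_item "route-NavierStokesRegularity-RootDecompFrugalCore", crux]
def FrugalCoreExtends : Prop :=
  ∀ (ν T : ℝ), 0 < ν → 0 < T → ∀ (u : ℝ → EuclideanSpace ℝ (Fin 3) → EuclideanSpace ℝ (Fin 3)) (p : ℝ → EuclideanSpace ℝ (Fin 3) → ℝ), Literature.Analysis.FluidPDE.IsClassicalNSSolutionOn (Set.Ico 0 T) ν 0 u p → Literature.Analysis.FluidPDE.IsLerayHopfOn T ν 0 (u 0) u → Literature.Analysis.FluidPDE.HasRapidSpatialDecay (u 0) → (∃ C M : ℝ, ∀ t₀ ∈ Set.Ico 0 T, ∃ t ∈ Set.Ico t₀ T, ∃ y : EuclideanSpace ℝ (Fin 3), (∀ s ∈ Set.Icc 0 t, ∀ x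 : EuclideanSpace ℝ (Fin 3), ‖u s x‖ ^ 2 ≤ C * (1 + ‖Literature.Analysis.FluidPDE.curl (u t) y‖)) ∧ ∀ s ∈ Set.Icc 0 t, ∫⁻ x, ENNReal.ofReal (Literature.Analysis.FluidPDE.frobeniusNormSq (fderiv ℝ (u s) x)) ≤ ENNReal.ofReal (M * Real.sqrt (1 + ‖Literature.Analysis.FluidPDE.curl (u t) y‖))) → Literature.Analysis.FluidPDE.HasSmoothExtensionPast ν 0 u T

/-- item stmt-NavierStokesRegularity-24827 · crux · rank 6 · open · by planner
why it might fail: it should not — CKN partial regularity gives it; only the typed limsup/ball form could be mis-stated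
sources: CKN1982, arXiv:0709.3599
[crux] P2 — NO ENERGY ATOM AT A FRAME TIME [the ATTACKED cell; = registered stub `stub_noEnergyAtom`
of crux stmt-19625 (Cruxes/WeakLambdaCriterion/Lines/birth.lean) VERBATIM, reused not re-invented;
tag WEAKER(evidence: 0056 ⇒ P2 KERNEL `noEnergyAtom_of_typeIIEnergyEquality`; S ⇒ P2 KERNEL (critic
`noEnergyAtom_of_root`, writer `noEnergyAtom_of_noBlowup`); in-NS separating classes where P2 is a
THEOREM: rate β<3/5 `leslieShvydkoy2018_noConcentration_of_rate`, Type I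
`noEnergyAtom_of_isTypeIBlowup`, enstrophy α<4/5 `noEnergyAtom_of_enstrophyRate` — critic CLEARED
2026-08-30T01:32:55Z, CRITIC-LEDGER row 7); leaf ATTACKABLE-by-inheritance (LS18/CKN engine; open =
LS18 Question 1.1 at dimension 0, arXiv:1705.04420 p.4) + INSTRUMENTABLE (exponent test: an atom
needs sup-rate β ≥ 3/5 and core radius γ ≤ 2β/3; Tao band test); BC5 rung LANDED: Type-I case
`Theorems.NoTerminalJolt.noEnergyAtom_of_isTypeIBlowup`]: a classical NS solution on ℝ³×[0,T) (zero
force), Leray–Hopf on [0,T] from its rapidly decaying datum, deposits no energy atom at time T: ∀x₀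
∀η>0 ∃r>0, ∫_{B_r(x₀)}|u(t)|² < η for all t<T close to T. [difficulty: open-problem] -/
@[route_item "route-NavierStokesRegularity-RootDecompFrugalCore", crux]
def NoEnergyAtom : Prop :=
  ∀ (ν T : ℝ), 0 < ν → 0 < T → ∀ (u : ℝ → EuclideanSpace ℝ (Fin 3) → EuclideanSpace ℝ (Fin 3)) (p : ℝ → EuclideanSpace ℝ (Fin 3) → ℝ), Literature.Analysis.FluidPDE.IsClassicalNSSolutionOn (Set.Ico 0 T) ν 0 u p → Literature.Analysis.FluidPDE.IsLerayHopfOn T ν 0 (u 0) u → Literature.Analysis.FluidPDE.HasRapidSpatialDecay (u 0) → ∀ (x₀ : EuclideanSpace ℝ (Fin 3)) (η : NNReal), 0 < η → ∃ r : ℝ, 0 < r ∧ ∀ᶠ t in nhdsWithin T (Set.Iio T), ∫⁻ x in Metric.ball x₀ r, ‖u t x‖ₑ ^ 2 < (η : ENNReal)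

/-- item stmt-NavierStokesRegularity-24829 · crux · rank 7 · open · by planner
why it might fail: a wild (non-L²-convergent) first blow-up without energy concentration at a point — energy escaping to a fractal terminal set (lens-5 Frostman axis)
sources: CKN1982, arXiv:2107.06509
[crux] J1 — AN ATOM-FREE FIRST BLOW-UP IS TAME [lens-2 J1 VERBATIM; RESIDUAL diffuse-dust cell; tag
WEAKER(evidence: E₁/18118 ⇒ J1 trivially, 0056 ⇒ J1 kernel via LS18 Thm 1.2 landed; separating
classes: atomic collapses and tame Type-II spikes, alive; omitted cell never constructed even in the
NSI relaxation — Scheffer/Ożański cascades are defect-free); leaf IDEA-NEEDED (GMT of the energy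
measure on the compact 𝓗¹-null singular slice Σ_T + dynamics; no named engine) — critic CLEARED
2026-08-30T01:32:55Z row 7 as the middle cell]: a maximal smooth solution with lifespan T,
Leray–Hopf from a rapidly decaying datum, which deposits no energy atom at T, has ‖u(t) − u(T)‖_{L²}
→ 0 as t ↑ T (NS cannot smear a positive energy quantum over an uncountable 𝓗¹-null dust). [deps:
NoEnergyAtom] [difficulty: open-problem] -/
@[route_item "route-NavierStokesRegularity-RootDecompFrugalCore", crux]
def AtomFreeBlowupIsTame : Prop :=
  ∀ (ν T : ℝ), 0 < ν → 0 < T → ∀ (u : ℝ → EuclideanSpace ℝ (Fin 3) → EuclideanSpace ℝ (Fin 3)) (p : ℝ → EuclideanSpace ℝ (Fin 3) → ℝ), Literature.Analysis.FluidPDE.IsMaximalSmoothSolution ν 0 u p T → Literature.Analysis.FluidPDE.IsLerayHopfOn T ν 0 (u 0) u → Literature.Analysis.FluidPDE.HasRapidSpatialDecay (u 0) → (∀ (x₀ : EuclideanSpace ℝ (Fin 3)) (η : NNReal), 0 < η → ∃ r : ℝ, 0 < r ∧ ∀ᶠ t in nhdsWithin T (Set.Iio T), ∫⁻ x in Metric.ball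 x₀ r, ‖u t x‖ₑ ^ 2 < (η : ENNReal)) → Filter.Tendsto (fun t => MeasureTheory.eLpNorm (u t - u T) 2 MeasureTheory.volume) (nhdsWithin T (Set.Iio T)) (nhds 0)

/-- item stmt-NavierStokesRegularity-1217 · crux · rank 8 · open · by planner
why it might fail: a discretely self-similar or non-scale-periodic Type-I singularity from a Schwartz datum; bounded-ancient Liouville open
sources: arXiv:0709.3599, arXiv:1811.00502, Tsai1998
[target] X = NO TYPE-I BLOW-UP FOR CLAY DATA: a classical solution of unforced NS on ℝ³×[0,T) which
is Leray–Hopf from a rapidly decaying datum and blows up at most at the Type-I rate ‖u(t)‖∞ ≤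
C(T−t)^{-1/2} extends smoothly past T. Equals UnthreadedNoBlowup ∧ ThreadedNoBlowup by excluded
middle on 'every point is unthreaded' (proved in the planner's Sketch.lean: target_of_cruxes); it is
the unconditional conclusion of stmt-NavierStokesRegularity-0058 (route TypeILiouville, which
assumes (L)). With NoTypeII (stmt-0056) it gives NoBlowup (stmt-0054). Card:
threading-flux-trace-topology. -/
@[route_item "route-NavierStokesRegularity-RootDecompFrugalCore", crux]
def NoTypeIBlowup : Prop :=
  ∀ (ν T : ℝ), 0 < ν → 0 < T → ∀ (u : ℝ → EuclideanSpace ℝ (Fin 3) → EuclideanSpace ℝ (Fin 3)) (p : ℝ → EuclideanSpace ℝ (Fin 3) → ℝ), Literature.Analysis.FluidPDE.IsClassicalNSSolutionOn (Set.Ico 0 T) ν 0 u p → Literature.Analysis.FluidPDE.IsLerayHopfOn T ν 0 (u 0) u → Literature.Analysis.FluidPDE.HasRapidSpatialDecay (u 0) → Literature.Analysis.FluidPDE.IsTypeIBlowup u T → Literature.Analysis.FluidPDE.HasSmoothExtensionPast ν 0 u T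

/-- item stmt-NavierStokesRegularity-29705 · support · rank 9 · open · by planner
why it might fail: each conjunct is an open criterion of the lineage: D₁ needs the unidirectional-curl Liouville input, D₂/D₃ are theorem-grade compactness (CZ, FZ) + landed/linear rigidity
sources: KochNadirashviliSereginSverak2009, arXiv:0709.3599, ConstantinFefferman1993
[support] THE BORN PARENT LAYER BY NAME: D₁ CoherentPacedExtends (stmt-27619, N9
RootDecompAlignedCore) ∧ D₂ ColumnarPacedExtends (stmt-28713, N11 RootDecompCoreDynamics) ∧ D₃
FrozenCoreExtends (stmt-28714, N11) — no new content; closes as ⟨h27619, h28713, h28714⟩ when those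
items close (attacked in N9/N11 with registered skeletons PZ / CZ / FZ+LL); bundled because the
verbatim 8-binder form is what BC1 forbids; never staffed on its own -/
@[route_item "route-NavierStokesRegularity-RootDecompFrugalCore", crux]
def StructuredCoresExtend : Prop :=
  Summit.NavierStokesRegularity.NavierStokesRegularity.Theses.RootDecompAlignedCore.CoherentPacedExtends ∧ Summit.NavierStokesRegularity.NavierStokesRegularity.Theses.RootDecompCoreDynamics.ColumnarPacedExtends ∧ Summit.NavierStokesRegularity.NavierStokesRegularity.Theses.RootDecompCoreDynamics.FrozenCoreExtends

/-- item stmt-NavierStokesRegularity-29706 · aside · rank 9 · open · by planner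
why it might fail: formalisation length only (Fatou for fderiv under the KNSS extraction; identification of the C¹_loc limit's enstrophy)
sources: KochNadirashviliSereginSverak2009, Seregin2014, arXiv:1402.1080
[support] ASIDE QZ FRUGAL PACE ZOOM — STUB 1 of D₅'s birth skeleton (named `stub_frugalPaceZoom`;
EXPECTED THEOREM, size M–L, FIRST PROVER TARGET; provers on D₅ land it `--supports`): a frugal-cored
classical Leray–Hopf solution with no smooth extension past T has a NONTRIVIAL frugal ancient flow
(bounded ancient mild, ν = 1, jointly smooth on (−∞,0)×ℝ³, enstrophy bounded uniformly in time, L⁶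
slices = EXACTLY the hypothesis list of X2 0893) as a tangent flow. Plan: PROVED
vorticityPace_paceZoom_proof (7781) at frugal records (`hasPaceWitness_of_isFrugalCore`, θ₀ = ν/(2
max(C,1))) + ENSTROPHY passenger ∫|∇v_k(s)|² = λ_k Z ≤ M' to the limit by Fatou on balls
(`lintegral_liminf_le`) + L⁶ passenger (Sobolev H¹ ⊂ L⁶, weak lsc) + `knss2009_smoothing_holds`;
non-triviality free (7781's slice is not a.e. constant). WEAKER than the EXISTING Z =
GaldiLiouvilleGate.RecordZoomAncient 0894 (kernel `frugalPaceZoom_of_recordZoomAncient`);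
S-necessary by vacuity -/
@[route_item "route-NavierStokesRegularity-RootDecompFrugalCore"]
def FrugalPaceZoom : Prop :=
  ∀ (ν T : ℝ), 0 < ν → 0 < T → ∀ (u : ℝ → EuclideanSpace ℝ (Fin 3) → EuclideanSpace ℝ (Fin 3)) (p : ℝ → EuclideanSpace ℝ (Fin 3) → ℝ), Literature.Analysis.FluidPDE.IsClassicalNSSolutionOn (Set.Ico 0 T) ν 0 u p → Literature.Analysis.FluidPDE.IsLerayHopfOn T ν 0 (u 0) u → Literature.Analysis.FluidPDE.HasRapidSpatialDecay (u 0) → (∃ C M : ℝ, ∀ t₀ ∈ Set.Ico 0 T, ∃ t ∈ Set.Ico t₀ T, ∃ y : EuclideanSpace ℝ (Fin 3), (∀ s ∈ Set.Icc 0 t, ∀ x : EuclideanSpace ℝ (Fin 3), ‖u s x‖ ^ 2 ≤ C * (1 + ‖Literature.Analysis.FluidPDE.curl (u t) y‖)) ∧ ∀ s ∈ Set.Icc 0 t, ∫⁻ x, ENNReal.ofReal (Literature.Analysis.FluidPDE.frobeniusNormSq (fderiv ℝ (u s) x)) ≤ ENNReal.ofReal (M * Real.sqrt (1 + ‖Literature.Analysis.FluidPDE.curl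 (u t) y‖))) → ¬ Literature.Analysis.FluidPDE.HasSmoothExtensionPast ν 0 u T → ∃ v : ℝ → EuclideanSpace ℝ (Fin 3) → EuclideanSpace ℝ (Fin 3), (Literature.Analysis.FluidPDE.IsBoundedAncientMildSolution 1 v ∧ ContDiffOn ℝ (⊤ : ℕ∞) (Function.uncurry v) (Set.Iio 0 ×ˢ Set.univ) ∧ (∃ C : NNReal, ∀ s < (0 : ℝ), ∫⁻ y, ENNReal.ofReal (Literature.Analysis.FluidPDE.frobeniusNormSq (fderiv ℝ (v s) y)) ≤ C) ∧ (∀ s < (0 : ℝ), MeasureTheory.MemLp (v s) 6 MeasureTheory.volume)) ∧ ¬ (∀ s < (0 : ℝ), ∀ y : EuclideanSpace ℝ (Fin 3), v s y = 0)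

/-- item stmt-NavierStokesRegularity-29707 · aside · rank 9 · open · by planner
why it might fail: it should not: zero-enstrophy limits are slice-wise constant and 7781 forbids that; formalisation only
sources: arXiv:1402.1080, KochNadirashviliSereginSverak2009
[support] ASIDE R₅ EVANESCENT CORES EXTEND — rung of D₅ (⟸ D₅ in kernel
`evanescentCoreExtends_of_frugalCoreExtends`; EXPECTED THEOREM, (L)- and X2-free, size M): if ∃ C ∀
ε > 0 cofinally a pace record below which the running enstrophy is ≤ ε√(1+W) (μ_Z → 0 along
records), the solution extends. Plan: QZ's extraction with ε_k → 0 gives a zoom limit with ZERO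
enstrophy on every ball, hence constant slices, contradicting 7781's non-constant slice. The
ℝ³/records analogue of Gibbon–Donzis–Gupta–Kerr–Pandit–Vincenzi's Regime-III regularity
(arXiv:1402.1080 p.9, 1 < m < ∞, 𝕋³) -/
@[route_item "route-NavierStokesRegularity-RootDecompFrugalCore"]
def EvanescentCoreExtends : Prop :=
  ∀ (ν T : ℝ), 0 < ν → 0 < T → ∀ (u : ℝ → EuclideanSpace ℝ (Fin 3) → EuclideanSpace ℝ (Fin 3)) (p : ℝ → EuclideanSpace ℝ (Fin 3) → ℝ), Literature.Analysis.FluidPDE.IsClassicalNSSolutionOn (Set.Ico 0 T) ν 0 u p → Literature.Analysis.FluidPDE.IsLerayHopfOn T ν 0 (u 0) u → Literature.Analysis.FluidPDE.HasRapidSpatialDecay (u 0) → (∃ C : ℝ, ∀ ε : ℝ, 0 < ε → ∀ t₀ ∈ Set.Ico 0 T, ∃ t ∈ Set.Ico t₀ T, ∃ y : EuclideanSpace ℝ (Fin 3), (∀ s ∈ Set.Icc 0 t, ∀ x : EuclideanSpace ℝ (Fin 3), ‖u s x‖ ^ 2 ≤ C * (1 + ‖Literature.Analysis.FluidPDE.curl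 (u t) y‖)) ∧ ∀ s ∈ Set.Icc 0 t, ∫⁻ x, ENNReal.ofReal (Literature.Analysis.FluidPDE.frobeniusNormSq (fderiv ℝ (u s) x)) ≤ ENNReal.ofReal (ε * Real.sqrt (1 + ‖Literature.Analysis.FluidPDE.curl (u t) y‖))) → Literature.Analysis.FluidPDE.HasSmoothExtensionPast ν 0 u T

/-- item stmt-NavierStokesRegularity-32101 · support · rank 9 · open · by planner
[support · AZ «ROUND PACE ZOOM» · NEW · EXPECTED THEOREM · FIRST PROVER TARGET of the ROUND CORE
split of 29703 (N17 rev 1, children R₉ 32092 / G₉ 32093, glue 32094) · lens-2 g9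
RoundCoreDichotomy.lean d78be15d… · size M–L] a ROUND core (IsRoundCore T u) of a maximal classical
Leray–Hopf solution from a rapidly decaying datum yields a bounded ancient mild solution (ν = 1)
with measurable slices which is AXISYMMETRIC about the canonical axis at every s < 0 (after a rigid
conjugation, `IsBoundedAncientMildSolution.conj_linearIsometryEquiv`, tree) and has a slice that is
not a.e. constant. Plan: PROVED `Theorems.vorticityPace_paceZoom_proof` (7781) at the round-core
points (pace witness `hasPaceWitness_of_isRoundCore`, KERNEL, via `not_bounded_of_maximal` + KNSS
Type II `hasSmoothExtensionPast_of_bounded_holds`) + uniform C¹ bounds on parabolic windows ⟹ the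
axial Lie defect passes to the limit and vanishes; (e_k, c′_k) subconverge (|c′_k| ≤ C); conjugate
to the x₃-axis; infinitesimal ⟹ global rotational invariance for C¹ fields. Shape = N11's aside CZ
ColumnarPaceZoom 28716 with the passenger ∂ₑu → 0 replaced by L_{e×(x−c)}u → 0 — SHARED
C¹-zoom-compactness support with lens-5 B♯ Rec -/
@[route_item "route-NavierStokesRegularity-RootDecompFrugalCore"]
def RoundPaceZoom : Prop :=
  ∀ (ν T : ℝ), 0 < ν → 0 < T → ∀ (u : ℝ → EuclideanSpace ℝ (Fin 3) → EuclideanSpace ℝ (Fin 3)) (p : ℝ → EuclideanSpace ℝ (Fin 3) → ℝ), Literature.Analysis.FluidPDE.IsMaximalSmoothSolution ν 0 u p T → Literature.Analysis.FluidPDE.IsLerayHopfOn T ν 0 (u 0) u → Literature.Analysis.FluidPDE.HasRapidSpatialDecay (u 0) → (∃ C : ℝ, ∀ A ε : ℝ, 0 < A → 0 < ε → ∀ t₀ ∈ Set.Ico 0 T, ∃ t ∈ Set.Ico t₀ T, ∃ y : EuclideanSpace ℝ (Fin 3), (∀ s ∈ Set.Icc 0 t, ∀ x : EuclideanSpace ℝ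 (Fin 3), ‖u s x‖ ^ 2 ≤ C * (1 + ‖Literature.Analysis.FluidPDE.curl (u t) y‖)) ∧ ∃ e c : EuclideanSpace ℝ (Fin 3), ‖e‖ = 1 ∧ ‖c - y‖ ≤ C / Real.sqrt (1 + ‖Literature.Analysis.FluidPDE.curl (u t) y‖) ∧ ∀ s ∈ Set.Icc 0 t, t - A / (1 + ‖Literature.Analysis.FluidPDE.curl (u t) y‖) ≤ s → ∀ x : EuclideanSpace ℝ (Fin 3), ‖x - y‖ ≤ A / Real.sqrt (1 + ‖Literature.Analysis.FluidPDE.curl (u t) y‖) → ‖fderiv ℝ (u s) x (Literature.Analysis.FluidPDE.cross e (x - c)) - Literature.Analysis.FluidPDE.cross e (u s x)‖ ≤ ε * Real.sqrt (1 + ‖Literature.Analysis.FluidPDE.curl (u t) y‖)) → ∃ v : ℝ → EuclideanSpace ℝ (Fin 3) → EuclideanSpace ℝ (Fin 3), Literature.Analysis.FluidPDE.IsBoundedAncientMildSolution 1 v ∧ (∀ s < (0 : ℝ), MeasureTheory.AEStronglyMeasurable (v s) MeasureTheory.volume) ∧ (∀ s < (0 : ℝ), Literature.Analysis.FluidPDE.IsAxisymmetric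 (v s)) ∧ ∃ s < (0 : ℝ), ¬ ∃ b : EuclideanSpace ℝ (Fin 3), v s =ᵐ[MeasureTheory.volume] fun _ => b

/-- item stmt-NavierStokesRegularity-32102 · support · rank 9 · open · by planner
[support · AxL♯ «THE AXISYMMETRIC LIOUVILLE CONJECTURE OF KNSS 2009 AS PRINTED» · ENGINE of the
ROUND CORE split (N17 rev 1) · S-FREE, INCOMPARABLE with S · NAMED OPEN PROBLEM: every bounded
ancient mild solution of NS (ν = 1) on ℝ³ with measurable slices, axisymmetric (canonical axis,
`Literature.Analysis.FluidPDE.IsAxisymmetric`) at every s < 0, is a.e. constant on every slice — NO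
bound on the swirl. Sources: KNSS Acta Math. 203 (2009) = arXiv:0709.3599 §5 p. 10 after Thm 5.2
«The validity of Theorem 5.2 in the absence of the no swirl assumption is still an open problem»;
Pan–Li arXiv:1908.11591 p. 2; Lei–Ren–Zhang arXiv:2101.04905 pp. 11–12. Tags: STRICTLY WEAKER than
(L) 10551/10661 (restriction to axisymmetric flows; kernel `axLSharp_of_liouville`, writer Sketch
`axL_of_liouville`); STRICTLY STRONGER than the canonical (AX-L) leaf
`Summit.NavierStokesRegularity.NavierStokesRegularity.AxisymmetricLiouvilleBoundedSwirl` (kernel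
`axL_of_axLSharp`; gap = unbounded swirl); PROVED rungs: Γ ≡ 0 (`axLSharp_noSwirl` =
`knss_axisymmetric_no_swirl'_holds`, KNSS Thm 5.2 LANDED) and |u| ≤ C/r
(`knss_bound_C_over_r_holds`, Thm 5.3). Used with AZ to close R₉ (`tameLavishRound_of`); the midd -/
@[route_item "route-NavierStokesRegularity-RootDecompFrugalCore"]
def AxisymmetricAncientLiouville : Prop :=
  ∀ v : ℝ → EuclideanSpace ℝ (Fin 3) → EuclideanSpace ℝ (Fin 3), Literature.Analysis.FluidPDE.IsBoundedAncientMildSolution 1 v → (∀ s < (0 : ℝ), MeasureTheory.AEStronglyMeasurable (v s) MeasureTheory.volume) → (∀ s < (0 : ℝ), Literature.Analysis.FluidPDE.IsAxisymmetric (v s)) → ∀ s < (0 : ℝ), ∃ b : EuclideanSpace ℝ (Fin 3), v s =ᵐ[MeasureTheory.volume] fun _ => b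

/-- item stmt-NavierStokesRegularity-32103 · support · rank 9 · open · by planner
[support · R₉⁰ «TAME LIVE LAVISH SWIRL-FREE-ROUND ⟹ TYPE I» · LOWEST RUNG of R₉ · THEOREM-GRADE =
the BC5 WITNESS of the ROUND CORE line (N17 rev 1): the parent's frame + IsSwirlFreeRoundCore T u
(round, and the scale-invariant swirl ⟨u(s,x), e × (x − c)⟩ about the axis is ≤ ε on the windows —
the tangent flow is axisymmetric WITHOUT swirl, the class of KNSS 2009 Thm 5.2, PROVED in the tree)
⟹ Type I. No symmetry of u itself is assumed (Ladyzhenskaya / Ukhovskii–Yudovich 1968 do not apply):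
a cell OUTSIDE S's known regime. WEAKER than R₉ (restriction via `isRoundCore_of_swirlFree`) and
than S (vacuity `tameLavishSwirlFreeRound_of_root`); CLOSED IN KERNEL modulo AZ⁰
SwirlFreeRoundPaceZoom ALONE (`tameLavishSwirlFreeRound_of`, via
`noSwirlFreeRoundCoreBlowup_of_zoom`; Liouville half = LANDED `knss_axisymmetric_no_swirl'_holds`) —
AZ⁰ = AZ + the zeroth-order passenger Γ ≤ ε_k → 0 (lens def SwirlFreeRoundPaceZoom, expected
theorem, same proof as AZ + one line; not filed as an item to keep N17 ≤ 15 items). Plan: prove AZ⁰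
⟹ this cell is a theorem. [difficulty: provable-now modulo AZ⁰ (M–L)] -/
@[route_item "route-NavierStokesRegularity-RootDecompFrugalCore"]
def TameLavishSwirlFreeRoundIsTypeI : Prop :=
  ∀ (ν T : ℝ), 0 < ν → 0 < T → ∀ (u : ℝ → EuclideanSpace ℝ (Fin 3) → EuclideanSpace ℝ (Fin 3)) (p : ℝ → EuclideanSpace ℝ (Fin 3) → ℝ), Literature.Analysis.FluidPDE.IsMaximalSmoothSolution ν 0 u p T → Literature.Analysis.FluidPDE.IsLerayHopfOn T ν 0 (u 0) u → Literature.Analysis.FluidPDE.HasRapidSpatialDecay (u 0) → Filter.Tendsto (fun t => MeasureTheory.eLpNorm (u t - u T) 2 MeasureTheory.volume) (nhdsWithin T (Set.Iio T)) (nhds 0) → ¬ ((∃ d : ℝ, 0 < d ∧ (∀ ε : ℝ, 0 < ε → ∃ δ : ℝ, 0 < δ ∧ ∀ t ∈ Set.Ico 0 T, ∀ x y : EuclideanSpace ℝ (Fin 3), d < ‖Literature.Analysis.FluidPDE.curl (u t) x‖ → d < ‖Literature.Analysis.FluidPDE.curl (u t) y‖ → ‖x - y‖ < δ → Real.sqrt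 (1 - (inner ℝ (‖Literature.Analysis.FluidPDE.curl (u t) x‖⁻¹ • Literature.Analysis.FluidPDE.curl (u t) x) (‖Literature.Analysis.FluidPDE.curl (u t) y‖⁻¹ • Literature.Analysis.FluidPDE.curl (u t) y)) ^ 2) ≤ ε)) ∧ (∃ C : ℝ, ∀ t₀ ∈ Set.Ico 0 T, ∃ t ∈ Set.Ico t₀ T, ∀ s ∈ Set.Icc 0 t, ∀ x : EuclideanSpace ℝ (Fin 3), ∃ y : EuclideanSpace ℝ (Fin 3), ‖u s x‖ ^ 2 ≤ C * (1 + ‖Literature.Analysis.FluidPDE.curl (u t) y‖))) → ¬ (∃ C : ℝ, ∀ A ε : ℝ, 0 < A → 0 < ε → ∀ t₀ ∈ Set.Ico 0 T, ∃ t ∈ Set.Ico t₀ T, ∃ y : EuclideanSpace ℝ (Fin 3), (∀ s ∈ Set.Icc 0 t, ∀ x : EuclideanSpace ℝ (Fin 3), ‖u s x‖ ^ 2 ≤ C * (1 + ‖Literature.Analysis.FluidPDE.curl (u t) y‖)) ∧ ∃ e : EuclideanSpace ℝ (Fin 3), ‖e‖ = 1 ∧ ∀ s ∈ Set.Icc 0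 t, t - A / (1 + ‖Literature.Analysis.FluidPDE.curl (u t) y‖) ≤ s → ∀ x : EuclideanSpace ℝ (Fin 3), ‖x - y‖ ≤ A / Real.sqrt (1 + ‖Literature.Analysis.FluidPDE.curl (u t) y‖) → ‖fderiv ℝ (u s) x e‖ ≤ ε * (1 + ‖Literature.Analysis.FluidPDE.curl (u t) y‖)) → ¬ (∃ C : ℝ, ∀ A ε : ℝ, 0 < A → 0 < ε → ∀ t₀ ∈ Set.Ico 0 T, ∃ t ∈ Set.Ico t₀ T, ∃ y : EuclideanSpace ℝ (Fin 3), (∀ s ∈ Set.Icc 0 t, ∀ x : EuclideanSpace ℝ (Fin 3), ‖u s x‖ ^ 2 ≤ C * (1 + ‖Literature.Analysis.FluidPDE.curl (u t) y‖)) ∧ ∃ c : EuclideanSpace ℝ (Fin 3), ‖c‖ ^ 2 ≤ C * (1 + ‖Literature.Analysis.FluidPDE.curl (u t) y‖) ∧ ∀ s ∈ Set.Icc 0 t, t - A / (1 + ‖Literature.Analysis.FluidPDE.curl (u t) y‖) ≤ s → ∀ x : EuclideanSpace ℝ (Fin 3), ‖x - y‖ ≤ A / Real.sqrt (1 + ‖Literature.Analysis.FluidPDE.curl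 (u t) y‖) → ‖Literature.Analysis.FluidPDE.curl (fun z => Literature.Analysis.FluidPDE.cross (Literature.Analysis.FluidPDE.curl (u s) z) (u s z - c)) x‖ ≤ ε * (1 + ‖Literature.Analysis.FluidPDE.curl (u t) y‖) ^ 2) → ¬ (∃ C M : ℝ, ∀ t₀ ∈ Set.Ico 0 T, ∃ t ∈ Set.Ico t₀ T, ∃ y : EuclideanSpace ℝ (Fin 3), (∀ s ∈ Set.Icc 0 t, ∀ x : EuclideanSpace ℝ (Fin 3), ‖u s x‖ ^ 2 ≤ C * (1 + ‖Literature.Analysis.FluidPDE.curl (u t) y‖)) ∧ ∀ s ∈ Set.Icc 0 t, ∫⁻ x, ENNReal.ofReal (Literature.Analysis.FluidPDE.frobeniusNormSq (fderiv ℝ (u s) x)) ≤ ENNReal.ofReal (M * Real.sqrt (1 + ‖Literature.Analysis.FluidPDE.curl (u t) y‖))) → (∃ C : ℝ, ∀ A ε : ℝ, 0 < A → 0 < ε → ∀ t₀ ∈ Set.Ico 0 T, ∃ t ∈ Set.Ico t₀ T, ∃ y : EuclideanSpace ℝ (Fin 3), (∀ s ∈ Set.Icc 0 t, ∀ x : EuclideanSpace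 ℝ (Fin 3), ‖u s x‖ ^ 2 ≤ C * (1 + ‖Literature.Analysis.FluidPDE.curl (u t) y‖)) ∧ ∃ e c : EuclideanSpace ℝ (Fin 3), ‖e‖ = 1 ∧ ‖c - y‖ ≤ C / Real.sqrt (1 + ‖Literature.Analysis.FluidPDE.curl (u t) y‖) ∧ ∀ s ∈ Set.Icc 0 t, t - A / (1 + ‖Literature.Analysis.FluidPDE.curl (u t) y‖) ≤ s → ∀ x : EuclideanSpace ℝ (Fin 3), ‖x - y‖ ≤ A / Real.sqrt (1 + ‖Literature.Analysis.FluidPDE.curl (u t) y‖) → ‖fderiv ℝ (u s) x (Literature.Analysis.FluidPDE.cross e (x - c)) - Literature.Analysis.FluidPDE.cross e (u s x)‖ ≤ ε * Real.sqrt (1 + ‖Literature.Analysis.FluidPDE.curl (u t) y‖) ∧ |inner ℝ (u s x) (Literature.Analysis.FluidPDE.cross e (x - c))| ≤ ε) → Literature.Analysis.FluidPDE.IsTypeIBlowup u T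

/-- item stmt-NavierStokesRegularity-29708 · assembly · rank 1 · open · by planner
sources: Fefferman2000, CKN1982
[assembly] the implication the glue proves: P1 → P2 → J1 → (D₁ ∧ D₂ ∧ D₃) → D₅ → E₂⁽⁶⁾ → Clay (A)
(all six consumed; = lens `closes_via_N11` through N11's `RootDecompCoreDynamics.closes`). -/
@[route_item "route-NavierStokesRegularity-RootDecompFrugalCore"]
def Assembly : Prop :=
  NoTypeIBlowup → NoEnergyAtom → AtomFreeBlowupIsTame → StructuredCoresExtend → FrugalCoreExtends → TameLavishIsTypeI → NavierStokesRegularity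

/-! D-0027 §2.1 — DECIDING THEOREM (planner-authored via `route open/edit --closes-file`; by planner-decomp-ns-writer-1-g3-0 2026-08-30T06:51:19Z):
its hypotheses are this route's items and its conclusion the sub-problem Statement (glue_lint), and it elaborates with this file. -/

@[closes "route-NavierStokesRegularity-RootDecompFrugalCore"] theorem closes (hI : NoTypeIBlowup) (hA : NoEnergyAtom) (hJ1 : AtomFreeBlowupIsTame) (hS : StructuredCoresExtend)
    (hD5 : FrugalCoreExtends) (hL6 : TameLavishIsTypeI) : NavierStokesRegularity := by
  refine Summit.NavierStokesRegularity.NavierStokesRegularity.Theses.RootDecompCoreDynamics.closes hS.2.1 hS.2.2 ?_ hS.1 hA hJ1 hI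
  intro ν T hν hT' u p hmax hLH hdec htame hK hcol hfr
  by_cases hfg : ∃ C M : ℝ, ∀ t₀ ∈ Set.Ico 0 T, ∃ t ∈ Set.Ico t₀ T, ∃ y : EuclideanSpace ℝ (Fin 3), (∀ s ∈ Set.Icc 0 t, ∀ x : EuclideanSpace ℝ (Fin 3), ‖u s x‖ ^ 2 ≤ C * (1 + ‖Literature.Analysis.FluidPDE.curl (u t) y‖)) ∧ ∀ s ∈ Set.Icc 0 t, ∫⁻ x, ENNReal.ofReal (Literature.Analysis.FluidPDE.frobeniusNormSq (fderiv ℝ (u s) x)) ≤ ENNReal.ofReal (M * Real.sqrt (1 + ‖Literature.Analysis.FluidPDE.curl (u t) y‖))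
  · exact absurd (hD5 ν T hν hT' u p hmax.1 hLH hdec hfg) hmax.2
  · exact hL6 ν T hν hT' u p hmax hLH hdec htame hK hcol hfr hfg

end Summit.NavierStokesRegularity.NavierStokesRegularity.Theses.RootDecompFrugalCore
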